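import Summits.QuantumFields.BalabanUV.Beta.FP.CompositeCovariancePeriodise

/-!
# `BalabanUV.Beta.FP.CompositeCovarianceJunction` — road «FP» for binder row D1, row **IR-5′ (a) «THE ff JUNCTION»** (owner ruling R-FP-35 (f)):
# **an2's `M`-PERIODISED FLUCTUATION COVARIANCE IS `½N²` TIMES BAŁABAN'S CONSTRAINED COVARIANCE `𝒞 = 𝒫G` OF (1.107) ON EVERY TORUS** —
# `Σ_{t∈ℤ^{d+1}} Γ_N((x, κ); (l, x′ − (NM)•t)) = (N²∕2) · 𝒞((x mod NM, κ), (x′ mod NM, l))`, every `N ≥ 1`, every torus `M`, every `d`, every dummy `a > 0`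
# (`𝒞` is `a`-free, `FluctuationProjection.Cov_indep`).  The `N²` is the `η⁻²` inside b05's stencils (`CurlOp (fine N M) N`), the `½` is an2's energy Hessian
# `curvAdj ∘ curv = 2·∂*∂` (GAPS C-leaf18-1 (b)); no other power enters — the last READING of the `G_k^{B5} ↔ KTot` unit dictionary (`IR5P-UNITS.md` §2, ff row) is
# now a kernel identity on the torus.

NOT IN PRINT; OUR PROOF.  HONEST FRAMING (cell contract, verbatim): «discharging `BetaPertH` makes Bałaban's UV stability UNCONDITIONAL — a real constructive-QFT
result; it is NOT the continuum limit and NOT the Clay problem.»  HONEST DEPENDENCY (verbatim): «continuum YM on T⁴ ⇐ BetaPertH ∧ nine spine estimates (0/9 proved);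
BetaPertH ⇐ (D1) ∧ (D4) ∧ CAP+tail; G-an2-4 gates asym, D1 and NE2/3/4.»  THIS MODULE proves NO estimate, instantiates NO wall binder, cites nothing as a hypothesis
(`B5.Prop12Printed` is NOT touched); finite-dimensional linear algebra over the two lineages' OWN typed objects BY NAME; one [our object] `def` (the torus column
`colG`); 0 sorry.  NOT IR-5′'s letters (F)(N)(I), NOT the de-periodised dictionary on `ℤ^{d+1}`, NOT hbook, NOT D1, NOT BetaPertH, NOT continuum, NOT Clay.

ABSOLUTE RULE (cell charter, verbatim): «No internally-minted statement may enter as a cited fact. Every hypothesis is either kernel-proved in this package or a verbatim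
quotation of a PUBLISHED theorem with page reference. The manuscript(s) under audit are NOT citable for their own disputed steps — they are the thing under adjudication;
programme-internal (2001/route/tribunal) claims are never citable.»

THE ARGUMENT (the Lagrange-function argument of [Balaban1984PropagatorsI] p. 34–35 (1.104)–(1.107), kernel-checked for the two typed objects; orientation only).
`V := {z : Q_kz = 0, R∂*z = 0}` (b05's fluctuation subspace at `U = 1`).  an2's torus column `u := colG b = av Γ^per_b` lies in `V` (zero block averages
`CompositeCovariancePeriodise.contourSum_Gper`; the slice from the G rows «`δdδΓ` block-constant», `gauge_Gper`, via `LandauMultiplierIdentities.PcT_eq_self_of_LapS_eq`)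
and satisfies the WEAK Euler–Lagrange identity `⟨z, ∂ᴴ∂u⟩ = N²·z̄_b` for every `z ∈ V` (the EL row `curvAdj_curv_Gper` through the bridges: the constraint force
`𝒬ᵀΦ` pairs to `⟨Q_kz, ·⟩ = 0`; the gauge force `dδdM^per` with block-mean-free `M^per` pairs to `⟨P∂*z, Δm⟩ = ⟨∂*z, PΔm⟩ = 0` because `PΔm = 0` when `Q′m = 0`
(`B5Value126.PcT_mulVec`, `B5LaplaceInverse.LapSinv_LapS_of_orth`); the periodic unit force pairs to `z̄_b`).  b05's column `v := 𝒞e_b` lies in `V` (`QvOp_mul_Cov`,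
`R_div_Cov`) with `⟨z, Δ_av⟩ = ⟨𝒫z, Δ_aGe_b⟩ = z̄_b` (`DeltaA_mul_Pproj_eq`, `DeltaA_mul_calG`, `Pproj_mulVec_of_mem`).  On `V × (anything)` the form of `Δ_a = ½∂ᴴ∂ +
∇(1−P)∇ᴴ + aQ*Q` (`BlockEffectiveAction.Kop`) reduces to `½⟨∂z, ∂y⟩` (`form_DeltaA_of_mem`).  Hence `w := u − (N²∕2)•v ∈ V` has `⟨w, Δ_aw⟩ = ½N²w̄_b − (N²∕2)w̄_b = 0`
and `w = 0` by the positivity of `Δ_a` (`B5DeltaA169.DeltaA_posDef`, p. 30 «Δ_a is a positive operator»).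

CONTENT (every `d`, `N ≥ 1`, torus `M`, dummy `a > 0`).  §1 bridges: `GradOp_liftT` (`∇_c(f∘lift) = c·av(df)`), `QsOp_liftT` (`Q′_k(f∘lift) = N^{−(d+1)}·(blockSum f)∘lift`),
`sum_liftT_eq` (torus sum = sum of block sums), **`R_divS_av_of_gauge`** (ANY periodic 1-form with block-constant gauge quantity lies on the slice — the mechanism of
`CompositeMinimiserJunction.R_divS_colA`, generalised), **`star_dotProduct_LapS_eq_zero`** (`⟨u, Δm⟩ = 0` for `Pu = u`, `Q′m = 0`, `Σm = 0`), `form_DeltaA_of_mem`.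
§2 [our object] `colG` + `QvOp_colG`, `R_divS_colG`, `av_curvAdj_curv_Gper` (the EL right member on the torus), **`weak_colG`**.  §3 b05's column: `QvOp_Cov_single`,
`R_div_Cov_single`, **`weak_Cov_single`**.  §4 **`colG_eq_smul_Cov : colG N M b = ((N:ℂ)^2 ∕ 2) • (Cov N hN M a ha *ᵥ Pi.single b 1)`**, **`colG_apply_eq_Cov`**,
**`tsum_Gam_pshift_eq_Cov`** (displayed above), `Cov_apply_im` (the (1.107) matrix is REAL).
Orientation only (nothing used as a hypothesis): [Balaban1984PropagatorsI] p. 17 «propagators, i.e. covariances of the Gaussian measure», pp. 34–35 (1.104)–(1.107), p. 30 «Δ_a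
is a positive operator»; [Balaban1985BackgroundPropagators] pp. 425–426 (3.148)–(3.153) «𝒢 = G₁ − G₁DRD*G₁ − G₁Q*(QG₁Q*)⁻¹QG₁ = G₁𝒫» (an2's READING D-an2.13, here PROVED for
the typed system at `U = 1` up to the displayed unit `N²∕2`).
Provenance: D1 formalisation swarm, unit `b2b-balaban-beta-d1-formalise-leaf-05` gen 15, 2026-08-21; owner GO R-FP-35 (f).
-/

open Finset
open scoped BigOperators ComplexConjugate Matrix ComplexOrder

namespace Summit.QuantumFields.BalabanUV.Beta.FP.CompositeCovarianceJunction

open Literature.MathematicalPhysics.QuantumFieldTheory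
open Literature.MathematicalPhysics.QuantumFieldTheory.Balaban1983to89
open Literature.MathematicalPhysics.QuantumFieldTheory.Balaban1983to89.Beta
open AffineAveraging (Site Form0 Form1 dz curv curvAdj codiff₁ box toSite blockSum contourSum)
open AffineReproduction (contourSumAdj)
open B5Prop11Plancherel (Tor fine calG)
open B5Block118 (QvOp QsOp bpt QsOp_mulVec)
open B5Blocks16 (blockOf)
open B5Action121 (CurlOp GradOp LapS divS sdiff GradOp_mulVec sdiff_mulVec GradOp_conjTranspose_mulVec_eq star_mulVec_dotProduct
  dotProduct_mulVec_eq_star_conjTranspose_mulVec)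
open B5Value126 (PcT PcT_mulVec PcT_conjTranspose)
open B5LaplaceInverse (LapSinv LapSinv_LapS_of_orth)
open B5DeltaA169 (DeltaA QvAdj DeltaA_mul_calG DeltaA_posDef)
open B5DivOrth (sum_divS sum_LapS)
open B5Adjoint130 (QsOp_adjoint_mulVec)
open LandauMultiplierIdentities (PcT_eq_self_of_LapS_eq)
open FluctuationProjection (Cov Pproj digitOf bpt_blockOf_digitOf Pproj_mulVec_of_mem DeltaA_mul_Pproj_eq QvOp_mul_Cov R_div_Cov)
open BlockEffectiveAction (Kop DeltaA_eq_Kop_add)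
open KKTFluctuationKernel (Gam)
open Summit.QuantumFields.BalabanUV.Beta.GAN24.TorusAvatar (toTor liftT Periodic av av_apply av_toTor av_add_unitVec toTor_liftT toTor_add toTor_unitVec toTor_bpt
  blockEquiv QvOp_av av_contourSumAdj curlAdj_curl_av sum_box_eq)
open Summit.QuantumFields.BalabanUV.Beta.GAN24.TorusPeriodise (pshift)
open Summit.QuantumFields.BalabanUV.Beta.FP.CompositeMinimiserJunction (periodic_codiff₁ periodic_dz divS_av LapS_liftT)
open Summit.QuantumFields.BalabanUV.Beta.FP.CompositeCovariancePeriodise (Gper GΦper GMper periodic_Gper periodic_GΦper periodic_GMper contourSum_Gper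
  gauge_Gper blockSum_GMper curvAdj_curv_Gper)

noncomputable section

/-! ## §1 Bridges and the two mechanisms (slice from the G rows; the gauge force is `Δ_a`-invisible on the slice) -/

section Bridges

variable {D : ℕ} {P : Fin D → ℕ} [∀ ν, NeZero (P ν)]

/-- **THE GRADIENT BRIDGE**: b05's `∇_c` (`B5Action121.GradOp`) of the avatar of a periodic scalar is `c` times the avatar of an2's `d`: `∇_c (f∘lift) = c • av (df)`. -/
theorem GradOp_liftT (c : ℕ) {f : Form0 D ℝ} (hf : Periodic P f) :
    (GradOp P (c : ℂ) *ᵥ fun w => ((f (liftT w) : ℝ) : ℂ)) = (c : ℂ) • av (dz f) := by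
  funext i
  rcases i with ⟨x, ν⟩
  have hp : f (liftT (x + B5Prop11Plancherel.unitVec P ν)) = f (liftT x + AffineAveraging.unitVec ν) :=
    hf.apply_liftT (by rw [toTor_add, toTor_liftT, toTor_unitVec])
  rw [GradOp_mulVec, sdiff_mulVec, Pi.smul_apply, av_apply, smul_eq_mul, hp]
  simp only [dz, Complex.ofReal_sub]

end Bridges

section Torus

variable {d : ℕ} (N : ℕ) [NeZero N] (M : Fin (d + 1) → ℕ) [∀ ν, NeZero (M ν)]

/-- **THE SCALAR AVERAGING BRIDGE**: b05's `Q′_k` ((1.20), `B5Block118.QsOp`) of the avatar of a `fine N M`-periodic scalar is `N^{−(d+1)}` times the avatar of an2's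
`blockSum N`. -/
theorem QsOp_liftT {f : Form0 (d + 1) ℝ} (hf : Periodic (fine N M) f) (y : Tor M) :
    (QsOp N M *ᵥ fun w => ((f (liftT w) : ℝ) : ℂ)) y = ((N : ℂ) ^ (d + 1))⁻¹ * ((blockSum N f (liftT y) : ℝ) : ℂ) := by
  rw [QsOp_mulVec, one_div]
  congr 1
  simp only [blockSum, Complex.ofReal_sum]
  rw [sum_box_eq]
  refine Finset.sum_congr rfl fun j _ => ?_
  rw [hf.apply_liftT (toTor_bpt N M y j)]

/-- The torus sum of the avatar of a periodic scalar is the sum of its block sums over the coarse torus. -/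
theorem sum_liftT_eq {f : Form0 (d + 1) ℝ} (hf : Periodic (fine N M) f) :
    ∑ x : Tor (fine N M), ((f (liftT x) : ℝ) : ℂ) = ∑ y : Tor M, ((blockSum N f (liftT y) : ℝ) : ℂ) := by
  rw [← Fintype.sum_equiv (blockEquiv N M) (fun p => ((f (liftT (bpt N M p.1 p.2)) : ℝ) : ℂ)) (fun x => ((f (liftT x) : ℝ) : ℂ)) (fun p => rfl),
    Fintype.sum_prod_type]
  refine Finset.sum_congr rfl fun y _ => ?_
  simp only [blockSum, Complex.ofReal_sum]
  rw [sum_box_eq]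
  refine Finset.sum_congr rfl fun j _ => ?_
  rw [hf.apply_liftT (toTor_bpt N M y j)]

/-- **THE SLICE MECHANISM** (`CompositeMinimiserJunction.R_divS_colA`, generalised to ANY column): a `fine N M`-periodic fine 1-form `A` on `ℤ^{d+1}` whose gauge
quantity `δdδA` is constant on every `N`-block has its avatar on Bałaban's hyperplane: `(1 − P)·∂*(av A) = 0`. -/
theorem R_divS_av_of_gauge {A : Form1 (d + 1) ℝ} (hA : ∀ κ, Periodic (fine N M) (A κ))
    (hG : ∀ (y : Site (d + 1)) (b : Fin (d + 1) → ℕ), b ∈ box (d + 1) N →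
      codiff₁ (dz (codiff₁ A)) ((N : ℤ) • y + toSite b) = codiff₁ (dz (codiff₁ A)) ((N : ℤ) • y)) :
    (1 - PcT N M (N : ℂ)) *ᵥ ((GradOp (fine N M) (N : ℂ))ᴴ *ᵥ av A) = 0 := by
  have hf : Periodic (fine N M) (codiff₁ A) := periodic_codiff₁ hA
  have hGp : Periodic (fine N M) (codiff₁ (dz (codiff₁ A))) := periodic_codiff₁ fun κ => periodic_dz hf κ
  set u : Tor (fine N M) → ℂ := divS (fine N M) (N : ℂ) (av A) with hu_def
  set V : Tor M → ℂ := fun y => (N : ℂ) * ((N : ℂ) * (N : ℂ)) * ((codiff₁ (dz (codiff₁ A)) ((N : ℤ) • liftT y) : ℝ) : ℂ) with hV_def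
  have e : u = (N : ℂ) • fun z => ((codiff₁ A (liftT z) : ℝ) : ℂ) := by
    funext z; rw [hu_def, divS_av N hA, Pi.smul_apply, smul_eq_mul]
  have hbpt : ∀ (y : Tor M) (j : Fin (d + 1) → Fin N), (LapS (fine N M) (N : ℂ) *ᵥ u) (bpt N M y j) = V y := by
    intro y j
    have hb : (fun i => (j i : ℕ)) ∈ box (d + 1) N := Fintype.mem_piFinset.2 fun i => Finset.mem_range.2 (j i).isLt
    rw [e, Matrix.mulVec_smul, Pi.smul_apply, smul_eq_mul, LapS_liftT N hf, hGp.apply_liftT (toTor_bpt N M y j), hG (liftT y) _ hb, hV_def]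
    ring
  have hblk : ∀ x, (LapS (fine N M) (N : ℂ) *ᵥ u) x = V (blockOf N M x) := by
    intro x
    conv_lhs => rw [← bpt_blockOf_digitOf N M x]
    exact hbpt _ _
  set g : Tor M → ℂ := fun y => (N : ℂ) ^ (d + 1) * V y with hg_def
  have hNc : ((N : ℂ) ^ (d + 1)) ≠ 0 := pow_ne_zero _ (Nat.cast_ne_zero.2 (NeZero.ne N))
  have h : LapS (fine N M) (N : ℂ) *ᵥ u = (QsOp N M)ᴴ *ᵥ g := by
    funext x
    rw [hblk, QsOp_adjoint_mulVec, hg_def]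
    field_simp
  have hu : ∑ x, u x = 0 := sum_divS (fine N M) (N : ℂ) (av A)
  have hsumV : ∑ x, (LapS (fine N M) (N : ℂ) *ᵥ u) x = ∑ y, (N : ℂ) ^ (d + 1) * V y := by
    rw [← Fintype.sum_equiv (blockEquiv N M) (fun p => (LapS (fine N M) (N : ℂ) *ᵥ u) (bpt N M p.1 p.2))
      (fun x => (LapS (fine N M) (N : ℂ) *ᵥ u) x) (fun p => rfl), Fintype.sum_prod_type]
    refine Finset.sum_congr rfl fun y _ => ?_
    simp only [hbpt, Finset.sum_const, Finset.card_univ, Fintype.card_pi, Fintype.card_fin, Finset.prod_const, nsmul_eq_mul]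
    push_cast
    ring
  have hg : ∑ y, g y = 0 := by
    rw [hg_def]
    show ∑ y, (N : ℂ) ^ (d + 1) * V y = 0
    rw [← hsumV]
    exact sum_LapS (fine N M) (N : ℂ) u
  have hP := PcT_eq_self_of_LapS_eq N M u g hu hg h
  rw [Matrix.sub_mulVec, Matrix.one_mulVec, GradOp_conjTranspose_mulVec_eq, ← hu_def, hP, sub_self]

/-- **THE GAUGE FORCE IS INVISIBLE ON THE SLICE**: for `u` in the range of `P` and a scalar `m` with zero block means and zero total sum, `⟨u, Δm⟩ = 0`
(`P` is Hermitian, `PΔm = Δ⁻¹Q′ᴴM⁻¹Q′(Δ⁻¹Δm) = Δ⁻¹Q′ᴴM⁻¹(Q′m) = 0`). -/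
theorem star_dotProduct_LapS_eq_zero {u m : Tor (fine N M) → ℂ} (hu : PcT N M (N : ℂ) *ᵥ u = u) (hQ : QsOp N M *ᵥ m = 0) (hm : ∑ x, m x = 0) :
    star u ⬝ᵥ (LapS (fine N M) (N : ℂ) *ᵥ m) = 0 := by
  have hc : (N : ℂ) ≠ 0 := Nat.cast_ne_zero.2 (NeZero.ne N)
  have hP : PcT N M (N : ℂ) *ᵥ (LapS (fine N M) (N : ℂ) *ᵥ m) = 0 := by
    rw [PcT_mulVec, LapSinv_LapS_of_orth (fine N M) hc m hm, hQ, Matrix.mulVec_zero, Matrix.mulVec_zero, Matrix.mulVec_zero]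
  rw [← hu, star_mulVec_dotProduct, PcT_conjTranspose, hP, dotProduct_zero]

variable (a : ℝ)

/-- **THE FORM OF `Δ_a` ON `V × (anything)`**: for `z` with zero block averages on the slice, `⟨z, Δ_ay⟩ = ½⟨∂z, ∂y⟩` for EVERY `y`
(`Δ_a = ½∂ᴴ∂ + ∇(1−P)∇ᴴ + aQ*Q`; the last two terms pair `z` through `(1−P)∇ᴴz = 0` and `Q_kz = 0`). -/
theorem form_DeltaA_of_mem {z : Tor (fine N M) × Fin (d + 1) → ℂ} (hzQ : QvOp N M *ᵥ z = 0)
    (hzR : (1 - PcT N M (N : ℂ)) *ᵥ ((GradOp (fine N M) (N : ℂ))ᴴ *ᵥ z) = 0) (y : Tor (fine N M) × Fin (d + 1) → ℂ) :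
    star z ⬝ᵥ (DeltaA N M a *ᵥ y) = (1 / 2 : ℂ) * (star z ⬝ᵥ (((CurlOp (fine N M) (N : ℂ))ᴴ * CurlOp (fine N M) (N : ℂ)) *ᵥ y)) := by
  have hRct : (1 - PcT N M (N : ℂ))ᴴ = 1 - PcT N M (N : ℂ) := by
    rw [Matrix.conjTranspose_sub, Matrix.conjTranspose_one, PcT_conjTranspose]
  have h2 : star z ⬝ᵥ ((GradOp (fine N M) (N : ℂ) * (1 - PcT N M (N : ℂ)) * (GradOp (fine N M) (N : ℂ))ᴴ) *ᵥ y) = 0 := by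
    rw [← Matrix.mulVec_mulVec, ← Matrix.mulVec_mulVec, dotProduct_mulVec_eq_star_conjTranspose_mulVec,
      dotProduct_mulVec_eq_star_conjTranspose_mulVec, hRct, hzR, star_zero, zero_dotProduct]
  have h3 : star z ⬝ᵥ ((QvAdj N M * QvOp N M) *ᵥ y) = 0 := by
    rw [← Matrix.mulVec_mulVec, QvAdj, Matrix.smul_mulVec, dotProduct_smul, dotProduct_mulVec_eq_star_conjTranspose_mulVec,
      Matrix.conjTranspose_conjTranspose, hzQ, star_zero, zero_dotProduct, smul_zero]
  rw [DeltaA_eq_Kop_add, Kop, Matrix.add_mulVec, Matrix.add_mulVec, dotProduct_add, dotProduct_add, Matrix.smul_mulVec, dotProduct_smul,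
    Matrix.smul_mulVec, dotProduct_smul, h2, h3, add_zero, smul_zero, add_zero, smul_eq_mul]

end Torus

/-! ## §2 an2's periodised covariance column on the torus: in `V`, weakly critical with the unit force -/

section An2

variable {d : ℕ} (N : ℕ) [NeZero N] (M : Fin (d + 1) → ℕ) [∀ ν, NeZero (M ν)]

/-- [our object] **an2's COVARIANCE COLUMN ON THE TORUS**: the avatar of the periodised column with source at the torus fine bond `b = (z̄′, l)`. -/
def colG (b : Tor (fine N M) × Fin (d + 1)) : Tor (fine N M) × Fin (d + 1) → ℂ := av (Gper N M b.2 (liftT b.1))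

/-- (T1) ZERO BLOCK AVERAGES: `Q_k (colG b) = 0`. -/
theorem QvOp_colG (b : Tor (fine N M) × Fin (d + 1)) : QvOp N M *ᵥ colG N M b = 0 := by
  funext i
  rcases i with ⟨y, μ⟩
  rw [colG, QvOp_av N M (periodic_Gper N M b.2 (liftT b.1)), contourSum_Gper, Pi.zero_apply]
  simp

/-- (T2) THE SLICE: `(1 − P)·∂*(colG b) = 0`. -/
theorem R_divS_colG (b : Tor (fine N M) × Fin (d + 1)) :
    (1 - PcT N M (N : ℂ)) *ᵥ ((GradOp (fine N M) (N : ℂ))ᴴ *ᵥ colG N M b) = 0 :=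
  R_divS_av_of_gauge N M (periodic_Gper N M b.2 (liftT b.1)) (fun y _ hb => gauge_Gper N M b.2 (liftT b.1) y hb)

/-- (T3) THE EULER–LAGRANGE RIGHT MEMBER ON THE TORUS: `av(d*dΓ^per_b) = N^{d+2}·Q_kᴴ(av Φ^per) + N⁻¹·∇_N((δdM^per)∘lift) + e_b`. -/
theorem av_curvAdj_curv_Gper (b : Tor (fine N M) × Fin (d + 1)) :
    av (curvAdj (curv (Gper N M b.2 (liftT b.1))))
      = ((N : ℂ) ^ (d + 2)) • ((QvOp N M)ᴴ *ᵥ av (GΦper N M b.2 (liftT b.1)))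
        + ((N : ℂ)⁻¹) • (GradOp (fine N M) (N : ℂ) *ᵥ fun w => ((codiff₁ (dz (GMper N M b.2 (liftT b.1))) (liftT w) : ℝ) : ℂ))
        + (Pi.single b (1 : ℂ) : Tor (fine N M) × Fin (d + 1) → ℂ) := by
  have hc : (N : ℂ) ≠ 0 := Nat.cast_ne_zero.2 (NeZero.ne N)
  have hg : Periodic (fine N M) (codiff₁ (dz (GMper N M b.2 (liftT b.1)))) :=
    periodic_codiff₁ fun κ => periodic_dz (periodic_GMper N M b.2 (liftT b.1)) κ
  rw [GradOp_liftT N hg, smul_smul, inv_mul_cancel₀ hc, one_smul]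
  funext i
  rcases i with ⟨z, κ⟩
  rw [Pi.add_apply, Pi.add_apply, Pi.smul_apply, smul_eq_mul, ← av_contourSumAdj N M (periodic_GΦper N M b.2 (liftT b.1)), av_apply, av_apply, av_apply,
    curvAdj_curv_Gper]
  push_cast
  congr 1
  by_cases h : ((z, κ) : Tor (fine N M) × Fin (d + 1)) = b
  · subst h
    simp
  · rw [Pi.single_eq_of_ne h]
    have h' : ¬ (κ = b.2 ∧ toTor (fine N M) (liftT z) = toTor (fine N M) (liftT b.1)) := by
      rintro ⟨hκ, hz⟩
      apply h
      rw [toTor_liftT, toTor_liftT] at hz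
      exact Prod.ext hz hκ
    rw [if_neg h']
    simp

/-- (T4) **WEAK CRITICALITY WITH THE UNIT FORCE**: for every `z ∈ V`, `⟨z, ∂ᴴ∂(colG b)⟩ = N²·z̄_b` — the constraint force pairs to `Q_kz = 0`, the gauge force is invisible on
the slice (`star_dotProduct_LapS_eq_zero`), the periodic unit force reads the entry. -/
theorem weak_colG (b : Tor (fine N M) × Fin (d + 1)) {z : Tor (fine N M) × Fin (d + 1) → ℂ} (hzQ : QvOp N M *ᵥ z = 0)
    (hzR : (1 - PcT N M (N : ℂ)) *ᵥ ((GradOp (fine N M) (N : ℂ))ᴴ *ᵥ z) = 0) :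
    star z ⬝ᵥ ((((CurlOp (fine N M) (N : ℂ))ᴴ * CurlOp (fine N M) (N : ℂ)) *ᵥ colG N M b)) = (N : ℂ) ^ 2 * star (z b) := by
  have hc : (N : ℂ) ≠ 0 := Nat.cast_ne_zero.2 (NeZero.ne N)
  have hm : Periodic (fine N M) (GMper N M b.2 (liftT b.1)) := periodic_GMper N M b.2 (liftT b.1)
  -- the gauge scalar `(δdM^per)∘lift = N⁻²·Δ_N(M^per∘lift)` and its invisibility
  have hgauge : star z ⬝ᵥ (GradOp (fine N M) (N : ℂ) *ᵥ fun w => ((codiff₁ (dz (GMper N M b.2 (liftT b.1))) (liftT w) : ℝ) : ℂ)) = 0 := by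
    have e : (fun w => ((codiff₁ (dz (GMper N M b.2 (liftT b.1))) (liftT w) : ℝ) : ℂ))
        = ((N : ℂ) * (N : ℂ))⁻¹ • (LapS (fine N M) (N : ℂ) *ᵥ fun w => ((GMper N M b.2 (liftT b.1) (liftT w) : ℝ) : ℂ)) := by
      funext w
      rw [Pi.smul_apply, LapS_liftT N hm, smul_eq_mul, ← mul_assoc, inv_mul_cancel₀ (mul_ne_zero hc hc), one_mul]
    have hu : PcT N M (N : ℂ) *ᵥ ((GradOp (fine N M) (N : ℂ))ᴴ *ᵥ z) = (GradOp (fine N M) (N : ℂ))ᴴ *ᵥ z := by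
      have := hzR
      rw [Matrix.sub_mulVec, Matrix.one_mulVec, sub_eq_zero] at this
      exact this.symm
    have hQm : QsOp N M *ᵥ (fun w => ((GMper N M b.2 (liftT b.1) (liftT w) : ℝ) : ℂ)) = 0 := by
      funext y
      rw [QsOp_liftT N M hm, blockSum_GMper, Pi.zero_apply]
      simp
    have hsm : ∑ x : Tor (fine N M), ((GMper N M b.2 (liftT b.1) (liftT x) : ℝ) : ℂ) = 0 := by
      rw [sum_liftT_eq N M hm]
      simp [blockSum_GMper]
    rw [e, Matrix.mulVec_smul, dotProduct_smul, dotProduct_mulVec_eq_star_conjTranspose_mulVec,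
      star_dotProduct_LapS_eq_zero N M hu hQm hsm, smul_zero]
  have hQ : star z ⬝ᵥ ((QvOp N M)ᴴ *ᵥ av (GΦper N M b.2 (liftT b.1))) = 0 := by
    rw [dotProduct_mulVec_eq_star_conjTranspose_mulVec, Matrix.conjTranspose_conjTranspose, hzQ, star_zero, zero_dotProduct]
  rw [colG, curlAdj_curl_av (fine N M) N (periodic_Gper N M b.2 (liftT b.1)), dotProduct_smul, av_curvAdj_curv_Gper, dotProduct_add, dotProduct_add,
    dotProduct_smul, dotProduct_smul, hQ, hgauge, dotProduct_single, smul_zero, smul_zero, zero_add, zero_add, smul_eq_mul, Pi.star_apply, mul_one]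

end An2

/-! ## §3 b05's column `𝒞e_b`: in `V`, with `⟨z, Δ_a𝒞e_b⟩ = z̄_b` on `V` -/

section B05

variable {d : ℕ} (N : ℕ) [NeZero N] (hN : 1 ≤ N) (M : Fin (d + 1) → ℕ) [∀ ν, NeZero (M ν)] (a : ℝ) (ha : 0 < a)

/-- `Q_k(𝒞e_b) = 0`. -/
theorem QvOp_Cov_single (b : Tor (fine N M) × Fin (d + 1)) : QvOp N M *ᵥ (Cov N hN M a ha *ᵥ Pi.single b 1) = 0 := by
  rw [Matrix.mulVec_mulVec, QvOp_mul_Cov, Matrix.zero_mulVec]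

/-- `R∂*(𝒞e_b) = 0`. -/
theorem R_div_Cov_single (b : Tor (fine N M) × Fin (d + 1)) :
    (1 - PcT N M (N : ℂ)) *ᵥ ((GradOp (fine N M) (N : ℂ))ᴴ *ᵥ (Cov N hN M a ha *ᵥ Pi.single b 1)) = 0 := by
  rw [Matrix.mulVec_mulVec, Matrix.mulVec_mulVec, R_div_Cov, Matrix.zero_mulVec]

/-- **`⟨z, Δ_a𝒞e_b⟩ = z̄_b` for `z ∈ V`**: `Δ_a𝒞 = Δ_a𝒫G = 𝒫ᴴΔ_aG = 𝒫ᴴ` and `𝒫z = z` on `V`. -/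
theorem weak_Cov_single (b : Tor (fine N M) × Fin (d + 1)) {z : Tor (fine N M) × Fin (d + 1) → ℂ} (hzQ : QvOp N M *ᵥ z = 0)
    (hzR : (1 - PcT N M (N : ℂ)) *ᵥ ((GradOp (fine N M) (N : ℂ))ᴴ *ᵥ z) = 0) :
    star z ⬝ᵥ (DeltaA N M a *ᵥ (Cov N hN M a ha *ᵥ Pi.single b 1)) = star (z b) := by
  have e : DeltaA N M a *ᵥ (Cov N hN M a ha *ᵥ Pi.single b 1) = (Pproj N hN M a ha)ᴴ *ᵥ Pi.single b 1 := by
    rw [Matrix.mulVec_mulVec, Cov, ← Matrix.mul_assoc, DeltaA_mul_Pproj_eq, Matrix.mul_assoc, DeltaA_mul_calG, Matrix.mul_one]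
  rw [e, dotProduct_mulVec_eq_star_conjTranspose_mulVec, Matrix.conjTranspose_conjTranspose, Pproj_mulVec_of_mem N hN M a ha z hzQ hzR,
    dotProduct_single, Pi.star_apply, mul_one]

end B05

/-! ## §4 THE JUNCTION: an2's periodised covariance column IS `(N²∕2)·𝒞e_b` -/

section Junction

variable {d : ℕ} (N : ℕ) [NeZero N] (hN : 1 ≤ N) (M : Fin (d + 1) → ℕ) [∀ ν, NeZero (M ν)] (a : ℝ) (ha : 0 < a)

/-- **THE ff JUNCTION an2 ↔ [B5], COLUMN FORM**: `colG b = (N²∕2) • 𝒞e_b` — the difference lies in `V` and is `Δ_a`-isotropic (`⟨w, Δ_aw⟩ = ½N²w̄_b − (N²∕2)w̄_b = 0`),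
hence vanishes by the positivity of `Δ_a`. -/
theorem colG_eq_smul_Cov (b : Tor (fine N M) × Fin (d + 1)) :
    colG N M b = (((N : ℂ) ^ 2) / 2) • (Cov N hN M a ha *ᵥ Pi.single b 1) := by
  set v := Cov N hN M a ha *ᵥ Pi.single b 1 with hv
  by_contra hne
  have hwQ : QvOp N M *ᵥ (colG N M b - (((N : ℂ) ^ 2) / 2) • v) = 0 := by
    rw [Matrix.mulVec_sub, Matrix.mulVec_smul, QvOp_colG, hv, QvOp_Cov_single, smul_zero, sub_zero]
  have hwR : (1 - PcT N M (N : ℂ)) *ᵥ ((GradOp (fine N M) (N : ℂ))ᴴ *ᵥ (colG N M b - (((N : ℂ) ^ 2) / 2) • v)) = 0 := by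
    rw [Matrix.mulVec_sub, Matrix.mulVec_sub, Matrix.mulVec_smul, Matrix.mulVec_smul, R_divS_colG, hv, R_div_Cov_single, smul_zero, sub_zero]
  have h0 : star (colG N M b - (((N : ℂ) ^ 2) / 2) • v) ⬝ᵥ (DeltaA N M a *ᵥ (colG N M b - (((N : ℂ) ^ 2) / 2) • v)) = 0 := by
    rw [Matrix.mulVec_sub, Matrix.mulVec_smul, dotProduct_sub, dotProduct_smul, form_DeltaA_of_mem N M a hwQ hwR (colG N M b),
      weak_colG N M b hwQ hwR, hv, weak_Cov_single N hN M a ha b hwQ hwR, smul_eq_mul]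
    ring
  have hpos := (DeltaA_posDef N hN M a ha).dotProduct_mulVec_pos (sub_ne_zero.2 hne)
  rw [h0] at hpos
  exact lt_irrefl _ hpos

/-- **ENTRYWISE**: `colG b i = (N²∕2) · 𝒞 i b`. -/
theorem colG_apply_eq_Cov (b i : Tor (fine N M) × Fin (d + 1)) :
    colG N M b i = ((N : ℂ) ^ 2 / 2) * Cov N hN M a ha i b := by
  rw [colG_eq_smul_Cov N hN M a ha, Pi.smul_apply, smul_eq_mul, Matrix.mulVec_single_one, Matrix.col_apply]

/-- **THE ff JUNCTION an2 ↔ [B5] IN an2's LETTERS**: for every fine bond `(x, κ)` of `ℤ^{d+1}` and every torus fine bond `(z̄′, l)`,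
`Σ_{t ∈ ℤ^{d+1}} Γ_N((x, κ); (l, lift z̄′ − (NM)•t)) = (N²∕2) · 𝒞((x mod NM, κ), (z̄′, l))` — the `M`-periodisation (over the source) of an2's fluctuation covariance
kernel (`KKTFluctuationKernel.Gam`, hard weak-gauge, unit lattice, energy `‖curv A‖²`) IS `½N²` times Bałaban's (1.107) constrained covariance `𝒞 = 𝒫G` as typed by b05
(`FluctuationProjection.Cov`); `N²` = the `η⁻²` of b05's stencils, `½` = an2's `curvAdj∘curv = 2∂*∂`. -/
theorem tsum_Gam_pshift_eq_Cov (κ l : Fin (d + 1)) (x : Site (d + 1)) (z' : Tor (fine N M)) :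
    (((∑' t : Site (d + 1), Gam (N := N) κ x l (liftT z' - pshift (fine N M) t)) : ℝ) : ℂ)
      = ((N : ℂ) ^ 2 / 2) * Cov N hN M a ha (toTor (fine N M) x, κ) (z', l) := by
  have e : (((∑' t : Site (d + 1), Gam (N := N) κ x l (liftT z' - pshift (fine N M) t)) : ℝ) : ℂ) = colG N M (z', l) (toTor (fine N M) x, κ) := by
    rw [colG, av_toTor (periodic_Gper N M l (liftT z'))]
    rfl
  rw [e, colG_apply_eq_Cov N hN M a ha]

/-- **THE (1.107) COVARIANCE MATRIX IS REAL**: every entry of b05's `𝒞` has zero imaginary part (it is `2∕N²` times a value of an2's real kernel `Γ^per`). -/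
theorem Cov_apply_im (i b : Tor (fine N M) × Fin (d + 1)) : (Cov N hN M a ha i b).im = 0 := by
  have hc : ((N : ℂ) ^ 2 / 2) ≠ 0 := div_ne_zero (pow_ne_zero _ (Nat.cast_ne_zero.2 (NeZero.ne N))) two_ne_zero
  have h := colG_apply_eq_Cov N hN M a ha b i
  rw [colG, av_apply] at h
  have e : Cov N hN M a ha i b = ((N : ℂ) ^ 2 / 2)⁻¹ * ((Gper N M b.2 (liftT b.1) i.2 (liftT i.1) : ℝ) : ℂ) := by
    rw [h, ← mul_assoc, inv_mul_cancel₀ hc, one_mul]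
  rw [e, show ((N : ℂ) ^ 2 / 2)⁻¹ = ((((N : ℝ) ^ 2 / 2)⁻¹ : ℝ) : ℂ) by push_cast; rfl, ← Complex.ofReal_mul, Complex.ofReal_im]

end Junction

end

end Summit.QuantumFields.BalabanUV.Beta.FP.CompositeCovarianceJunction
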